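import Summits.Ventures.HodgeRepro2.T5SU11JacobiPhaseLawAsymptotic
import Summits.Ventures.HodgeRepro2.T5SU11PhaseTail

/-!
# The tail of the phase on the group for every `λ`, and the limit law on `G`

`T5SU11PhaseTail` gives the exact tail of the phase at `λ = 0`. Here, for every `λ` and `k` on the ray,
the tail of `m_k φ_λ dν` is identified with its phase form through the law of the phase for measurable
`[0, ∞]`-valued functions (`T5SU11PhaseTail.lintegral_phase_eq_measurable`):

  **`∫_{t < log|a(g)|} m_k φ_λ dν = 2π ∫_t^∞ e^{−(k−2)s} Φ_λ(s) ds`**,  `t ≥ 0`   (`integral_phase_tail_eq`)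

(the indicator of `{t < log|a|}` is `(Ioi t).indicator` read in the phase, the Bochner integrals are
converted to lower integrals of `ofReal` and back — integrability from the criterion
`T5SU11PhaseLawLintegral.integrable_phase_iff`). Consequently the limit law of
`T5SU11JacobiPhaseLawAsymptotic` reads on the group: for the probability measure `m_k φ_λ dν / m̂_k(λ)`,

  **`P_{k,λ}(k · log|a| > x) → e^{−x}`**   (`tendsto_phase_tail_prob_atTop`)

for every real `λ` and every `x ≥ 0` — the rescaled phase converges in distribution to the standard
exponential law. Nothing is claimed about (N).

Blind lane: Mathlib + the HodgeRepro2 prefix only; no sorry; axioms ⊆ {propext, Classical.choice,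
Quot.sound}.
-/

namespace Summit.Ventures.HodgeRepro2.T5SU11JacobiPhaseTailGroup

open MeasureTheory MeasureTheory.Measure Metric Set Filter Topology
open T5SU11Unimodular T5SU11Fibration T5SU11Cartan T5SU11OneParameter T5SU11CartanProjection T5HaarCircle
  T5BergmanCoefficient T5SU11FibrationHaar T5SU11SphericalFunction T5SU11SphericalSymmetry
  T5SU11SphericalBounds T5SU11SphericalContinuous T5SU11JacobiIwasawa T5SU11JacobiTransform
  T5SU11JacobiWeight T5SU11KFiniteMajorantPow T5SU11JacobiWeightDeriv T5SU11PhaseLaw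
  T5SU11PhaseLawLintegral T5SU11JacobiLaplacePhase T5SU11PhaseTail T5SU11JacobiPhaseLawAsymptotic
open scoped Real ENNReal

/-- The set `{t < log|a(g)|}` is measurable (open). -/
theorem measurableSet_phase_gt (t : ℝ) : MeasurableSet {g : SU11 | t < Real.log ‖mat g 0 0‖} :=
  (isOpen_lt continuous_const continuous_log_norm_mat).measurableSet

section measure

variable [MeasurableSpace Circle] [BorelSpace Circle]

/-- `e^{−(k−2)s} Φ_λ(s)` is integrable on `(0, ∞)` for `k` on the ray (the integrability criterion of the
law of the phase applied to `m_k φ_λ`). -/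
theorem integrableOn_exp_mul_sphPhase {k lam : ℝ} (hk : 1 < k) (h1 : lam < k) (h2 : 2 < k + lam) :
    IntegrableOn (fun s : ℝ => Real.exp (-((k - 2) * s)) * sphPhase lam s) (Ioi 0) := by
  have hF : Continuous fun s : ℝ => Real.exp (-(k * s)) * sphPhase lam s :=
    (Real.continuous_exp.comp (continuous_const.mul continuous_id).neg).mul (continuous_sphPhase lam)
  have hF0 : ∀ s, 0 ≤ s → 0 ≤ Real.exp (-(k * s)) * sphPhase lam s := fun s _ =>
    mul_nonneg (Real.exp_pos _).le (sphPhase_pos lam s).le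
  have hint : Integrable (fun g => (fun s : ℝ => Real.exp (-(k * s)) * sphPhase lam s)
      (Real.log ‖mat g 0 0‖)) (nu haarCircle) := by
    refine (integrable_orbit_rpow_mul_sph hk h1 h2).congr (Filter.Eventually.of_forall fun g => ?_)
    simp only
    rw [orbit_rpow_eq_exp, sph_eq_sphPhase]
  have h := (integrable_phase_iff hF hF0).mp hint
  refine h.congr_fun (fun s _ => ?_) measurableSet_Ioi
  show Real.exp (-(k * s)) * sphPhase lam s * Real.exp (2 * s) = Real.exp (-((k - 2) * s)) * sphPhase lam s
  rw [mul_right_comm, ← Real.exp_add]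
  congr 2
  ring

/-- **THE TAIL OF THE PHASE ON THE GROUP, IN PHASE FORM**: for `k` on the ray and `t ≥ 0`,
`∫_{t < log|a(g)|} m_k φ_λ dν = 2π ∫_t^∞ e^{−(k−2)s} Φ_λ(s) ds`. -/
theorem integral_phase_tail_eq {k lam : ℝ} (hk : 1 < k) (h1 : lam < k) (h2 : 2 < k + lam) {t : ℝ}
    (ht : 0 ≤ t) :
    ∫ g in {g : SU11 | t < Real.log ‖mat g 0 0‖}, (1 - ‖orbit g‖ ^ 2) ^ (k / 2) * sph lam g ∂(nu haarCircle)
      = 2 * π * ∫ s in Ioi t, Real.exp (-((k - 2) * s)) * sphPhase lam s := by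
  set S : Set SU11 := {g : SU11 | t < Real.log ‖mat g 0 0‖} with hS
  have hSm : MeasurableSet S := measurableSet_phase_gt t
  set f : SU11 → ℝ := fun g => (1 - ‖orbit g‖ ^ 2) ^ (k / 2) * sph lam g with hf
  have hf0 : ∀ g, 0 ≤ f g := fun g => mul_nonneg (orbit_rpow_nonneg k g) (sph_pos lam g).le
  have hfc : Continuous f := (continuous_orbit_rpow k).mul (continuous_sph lam)
  -- the phase-side functions
  set h : ℝ → ℝ := fun s => Real.exp (-((k - 2) * s)) * sphPhase lam s with hh
  have hh0 : ∀ s, 0 ≤ h s := fun s => mul_nonneg (Real.exp_pos _).le (sphPhase_pos lam s).le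
  set G : ℝ → ℝ≥0∞ := fun s => (Ioi t).indicator
    (fun s => ENNReal.ofReal (Real.exp (-(k * s)) * sphPhase lam s)) s with hG
  have hGm : Measurable G :=
    (ENNReal.measurable_ofReal.comp ((Real.continuous_exp.comp
      (continuous_const.mul continuous_id).neg).mul (continuous_sphPhase lam)).measurable).indicator
      measurableSet_Ioi
  -- step 1: the group integral as a lower integral of the phase-side `G`
  have e1 : ∀ g : SU11, ENNReal.ofReal (S.indicator f g) = G (Real.log ‖mat g 0 0‖) := fun g => by
    by_cases hg : g ∈ S
    · have hg' : Real.log ‖mat g 0 0‖ ∈ Ioi t := hg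
      rw [indicator_of_mem hg, hG]
      simp only
      rw [indicator_of_mem hg', hf]
      simp only
      rw [orbit_rpow_eq_exp, sph_eq_sphPhase]
    · have hg' : Real.log ‖mat g 0 0‖ ∉ Ioi t := hg
      rw [indicator_of_notMem hg, hG]
      simp only
      rw [indicator_of_notMem hg', ENNReal.ofReal_zero]
  have step1 : ∫ g in S, f g ∂(nu haarCircle)
      = ENNReal.toReal (∫⁻ g, G (Real.log ‖mat g 0 0‖) ∂(nu haarCircle)) := by
    rw [← integral_indicator hSm, integral_eq_lintegral_of_nonneg_ae
      (Filter.Eventually.of_forall fun g => indicator_nonneg (fun g _ => hf0 g) g)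
      (hfc.aestronglyMeasurable.indicator hSm)]
    congr 1
    exact lintegral_congr fun g => e1 g
  -- step 2: the law of the phase, and the phase-side lower integral as a Bochner integral
  have e2 : ∀ s : ℝ, G s * ENNReal.ofReal (Real.exp (2 * s))
      = ENNReal.ofReal ((Ioi t).indicator h s) := fun s => by
    by_cases hs : s ∈ Ioi t
    · rw [hG]
      simp only
      rw [indicator_of_mem hs, indicator_of_mem hs, ← ENNReal.ofReal_mul
        (mul_nonneg (Real.exp_pos _).le (sphPhase_pos lam s).le), hh]
      simp only
      congr 1
      rw [mul_right_comm, ← Real.exp_add]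
      congr 2
      ring
    · rw [hG]
      simp only
      rw [indicator_of_notMem hs, indicator_of_notMem hs, zero_mul, ENNReal.ofReal_zero]
  have hint : IntegrableOn ((Ioi t).indicator h) (Ioi 0) :=
    (integrableOn_exp_mul_sphPhase hk h1 h2).indicator measurableSet_Ioi
  have step2 : ∫⁻ g, G (Real.log ‖mat g 0 0‖) ∂(nu haarCircle)
      = ENNReal.ofReal (2 * π) * ENNReal.ofReal (∫ s in Ioi (0 : ℝ), (Ioi t).indicator h s) := by
    rw [lintegral_phase_eq_measurable G hGm]
    congr 1
    rw [ofReal_integral_eq_lintegral_ofReal hint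
      (Filter.Eventually.of_forall fun s => indicator_nonneg (fun s _ => hh0 s) s)]
    exact lintegral_congr fun s => e2 s
  -- step 3: the indicator integral over `(0, ∞)` is the integral over `(t, ∞)`
  have step3 : ∫ s in Ioi (0 : ℝ), (Ioi t).indicator h s = ∫ s in Ioi t, h s := by
    rw [integral_indicator measurableSet_Ioi, Measure.restrict_restrict measurableSet_Ioi,
      Ioi_inter_Ioi, show max t 0 = t from max_eq_left ht]
  have hnn : 0 ≤ ∫ s in Ioi t, h s := integral_nonneg fun s => hh0 s
  rw [step1, step2, step3, ENNReal.toReal_mul, ENNReal.toReal_ofReal (by positivity),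
    ENNReal.toReal_ofReal hnn]

/-- **THE LIMIT LAW ON THE GROUP**: for every `λ` and `x ≥ 0`, the `m_k φ_λ dν/m̂_k(λ)`-probability of
`{k · log|a(g)| > x}` tends to `e^{−x}` as `k → ∞`. -/
theorem tendsto_phase_tail_prob_atTop (lam : ℝ) {x : ℝ} (hx : 0 ≤ x) :
    Tendsto (fun k : ℝ =>
        (∫ g in {g : SU11 | x / k < Real.log ‖mat g 0 0‖},
            (1 - ‖orbit g‖ ^ 2) ^ (k / 2) * sph lam g ∂(nu haarCircle))
          / ∫ g, (1 - ‖orbit g‖ ^ 2) ^ (k / 2) * sph lam g ∂(nu haarCircle))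
      atTop (𝓝 (Real.exp (-x))) := by
  refine (tendsto_phase_tail_atTop lam hx).congr' ?_
  filter_upwards [eventually_gt_atTop (max 2 (max lam (2 - lam)))] with k hk
  rw [max_lt_iff, max_lt_iff] at hk
  rw [integral_phase_tail_eq (by linarith) (by linarith) (by linarith) (div_nonneg hx (by linarith))]

end measure

end Summit.Ventures.HodgeRepro2.T5SU11JacobiPhaseTailGroup
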